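import Mathlib.FieldTheory.RatFunc.AsPolynomial
import Mathlib.RingTheory.Polynomial.Tower
import Mathlib.Algebra.Polynomial.Inductions
import Mathlib.RingTheory.DedekindDomain.IntegralClosure
import Mathlib.RingTheory.DedekindDomain.AdicValuation
import Mathlib.FieldTheory.Perfect
import Literature.NumberTheory.Transcendental.LandauDefectLattice
import HarnessLib

/-!
# Tate families in one cube variable: poles run to infinity, so `Λ(F)` is the exact relation lattice

Topic `Literature/NumberTheory/Transcendental`; continuation of `LandauDefectLattice.lean`
(definition request `defn-LandauDefectLattice`, route InverseLandau).

A **Tate family** in one cube variable over the constant field `k` is a pair `P, Q ∈ k[z][ϖ]`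
(polynomials in the parameter `ϖ` with coefficients in `k[z]`) with `Q(z, 0) = c₀ ∈ k^×` a non-zero
constant; the integrand is `F = P/Q ∈ k(ϖ)(z)`, and since `Q ≡ c₀ (mod ϖ)` is invertible in
`k[z][[ϖ]]` its `ϖ`-expansion is a `t`-free rational element of Ayoub's `𝒪†_alg`
(`AyoubRelative.lean`).

* `TateFamily₁ k`; `TateFamily₁.toRatFunc : RatFunc (RatFunc k)` (`F` as a rational function of `z`
  over `K₀ = k(ϖ)`, via `toParamPoly : k[z][ϖ] → k(ϖ)[z]`); the two-variable evaluation `evalAt`;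
  and the wrappers `TateFamily₁.paramField / landauSet / incidenceMatrix / defectLattice`.
* **`TateFamily₁.one_lt_val_of_mem_landauSet`** (proved): at every place `c` of a parameter field
  `K ⊇ k(ϖ)` lying over `ϖ = 0` (`val_c ϖ < 1`), every pole branch `p ∈ K` of `F(·; ϖ)` has a pole,
  `1 < val_c p` ("the poles run to infinity as `ϖ → 0`"): otherwise `0 = Q(p; ϖ) ≡ c₀ (mod 𝔪_c)`
  would give `val_c c₀ < 1`, contradicting `val_c c₀ = 1`.
* **`Landau.Place.exists_val_X_lt_one`** (proved): every finite separable extension `K` of `k(ϖ)`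
  has a place over `ϖ = 0` (a prime of the integral closure of `k[ϖ]` in `K` over `(ϖ)` — going up,
  Dedekind — and its adic valuation; Stichtenoth Prop. 3.1.7 (b)).
* **`TateFamily₁.landauDefectLattice_eq_relationLattice`** (proved): consequently, over any such
  `K`, the defect lattice `Λ(F)` (relations among the `g_p = (p-1)/p` modulo constants) is the
  lattice of EXACT multiplicative relations `∏ g_p^{n_p} = 1`; on the canonical parameter field and
  in characteristic `0` this holds unconditionally (`TateFamily₁.defectLattice_eq_relationLattice`)
  — at a Tate point no constant survives.

Not here: the expansion map from a Tate family to `AyoubRel.Odagger` (term-by-term `ϖ`-expansion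
of `P/Q`).

## References
* H. Stichtenoth, *Algebraic Function Fields and Codes*, GTM 254 (2009), §1.1, Prop. 3.1.7
  (`Stichtenoth2009`).
* J. Ayoub, *La version relative de la conjecture des périodes de Kontsevich–Zagier revisitée*,
  §1.2 (`AyoubRelKZRevisited`) — the Tate degeneration `ϖ → 0`.
-/

noncomputable section

open scoped WithZero
open Polynomial

namespace Literature.NumberTheory.Transcendental.AyoubRel

/-! ### Places over `ϖ = 0` exist on every finite extension of `k(ϖ)` -/

section PlaceOverZero

variable (k : Type*) (K : Type*) [Field k] [Field K] [Algebra k K] [Algebra (Polynomial k) K]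
  [Algebra (RatFunc k) K] [IsScalarTower k (RatFunc k) K] [IsScalarTower (Polynomial k) (RatFunc k) K]
  [FiniteDimensional (RatFunc k) K] [Algebra.IsSeparable (RatFunc k) K]

/-- **A place over `ϖ = 0`.** Every finite separable extension `K` of `k(ϖ)` carries a place `c`
(a normalised discrete valuation trivial on `k`) with `val_c ϖ < 1`: a prime of the integral closure
of `k[ϖ]` in `K` lying over `(ϖ)` (going up; the integral closure is a Dedekind domain) and its adic
valuation. [cite: Stichtenoth2009, Prop. 3.1.7] -/
theorem Landau.Place.exists_val_X_lt_one :
    ∃ c : Landau.Place k K, c.val (algebraMap (RatFunc k) K RatFunc.X) < 1 := by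
  classical
  let S := integralClosure (Polynomial k) K
  haveI : IsDedekindDomain S := integralClosure.isDedekindDomain (Polynomial k) (RatFunc k) K
  haveI : IsFractionRing S K :=
    integralClosure.isFractionRing_of_finite_extension (RatFunc k) K
  -- the maximal ideal `(ϖ)` of `k[ϖ]` and a maximal ideal `Q` of `S` over it
  let P : Ideal (Polynomial k) := Ideal.span {X}
  haveI hP : P.IsMaximal := PrincipalIdealRing.isMaximal_of_irreducible Polynomial.irreducible_X
  have hinjK : Function.Injective (algebraMap (Polynomial k) K) := by
    rw [IsScalarTower.algebraMap_eq (Polynomial k) (RatFunc k) K]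
    exact (algebraMap (RatFunc k) K).injective.comp (IsFractionRing.injective (Polynomial k) (RatFunc k))
  have hinjS : Function.Injective (algebraMap (Polynomial k) S) := by
    intro a b hab
    apply hinjK
    rw [IsScalarTower.algebraMap_apply (Polynomial k) S K, hab,
      ← IsScalarTower.algebraMap_apply (Polynomial k) S K]
  obtain ⟨Q, hQmax, hQ⟩ := Ideal.exists_ideal_over_maximal_of_isIntegral (S := S) P (by
    rw [(RingHom.injective_iff_ker_eq_bot _).1 hinjS]; exact bot_le)
  have hXQ : algebraMap (Polynomial k) S X ∈ Q := by
    rw [← Ideal.mem_comap, hQ]; exact Ideal.mem_span_singleton_self X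
  have hQne : Q ≠ ⊥ := by
    intro h
    rw [h, Ideal.mem_bot, map_eq_zero_iff _ hinjS] at hXQ
    exact Polynomial.X_ne_zero hXQ
  let v : IsDedekindDomain.HeightOneSpectrum S := ⟨Q, hQmax.isPrime, hQne⟩
  obtain ⟨π, hπ⟩ := v.valuation_exists_uniformizer K
  -- triviality on the constants: a non-zero constant is a unit of `k[ϖ]`, hence not in `Q`
  haveI : (v.valuation K).IsTrivialOn k := ⟨fun a ha => by
    have e : algebraMap k K a = algebraMap S K (algebraMap (Polynomial k) S (C a)) := by
      rw [← IsScalarTower.algebraMap_apply (Polynomial k) S K,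
        IsScalarTower.algebraMap_apply (Polynomial k) (RatFunc k) K, Polynomial.C_eq_algebraMap,
        ← IsScalarTower.algebraMap_apply k (Polynomial k) (RatFunc k),
        ← IsScalarTower.algebraMap_apply k (RatFunc k) K]
    rw [e, IsDedekindDomain.HeightOneSpectrum.valuation_eq_one_iff_notMem]
    intro hmem
    have hu : IsUnit (algebraMap (Polynomial k) S (C a)) :=
      (Polynomial.isUnit_C.2 (IsUnit.mk0 a ha)).map _
    exact hQmax.ne_top (Ideal.eq_top_of_isUnit_mem _ hmem hu)⟩
  refine ⟨Landau.Place.ofPrimeElement (k := k) (v.valuation K) π hπ, ?_⟩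
  show v.valuation K (algebraMap (RatFunc k) K RatFunc.X) < 1
  have e : algebraMap (RatFunc k) K RatFunc.X = algebraMap S K (algebraMap (Polynomial k) S X) := by
    rw [← IsScalarTower.algebraMap_apply (Polynomial k) S K, ← RatFunc.algebraMap_X,
      ← IsScalarTower.algebraMap_apply (Polynomial k) (RatFunc k) K]
  rw [e]
  exact (IsDedekindDomain.HeightOneSpectrum.valuation_lt_one_iff_mem v _).2 hXQ

end PlaceOverZero

/-- A **Tate family in one cube variable** over the constant field `k`: `F = P/Q` with
`P, Q ∈ k[z][ϖ]` (polynomials in the parameter `ϖ` whose coefficients are polynomials in the cube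
variable `z`) and `Q(z, 0) = c₀` a NON-ZERO CONSTANT, so that `1/Q`, hence `F`, expands as a power
series in `ϖ` with coefficients in `k[z]`, and every pole branch of `F(·; ϖ)` runs to infinity as
`ϖ → 0`. [folklore] -/
structure TateFamily₁ (k : Type*) [Field k] where
  /-- the numerator `P ∈ k[z][ϖ]` -/
  P : Polynomial (Polynomial k)
  /-- the denominator `Q ∈ k[z][ϖ]` -/
  Q : Polynomial (Polynomial k)
  /-- the constant `c₀ = Q(z, 0)` -/
  c₀ : k
  /-- `c₀ ≠ 0` -/
  c₀_ne_zero : c₀ ≠ 0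
  /-- `Q(z, 0) = c₀`: the `ϖ⁰`-coefficient of `Q` is the constant polynomial `c₀ ∈ k[z]` -/
  coeff_Q_zero : Q.coeff 0 = Polynomial.C c₀

namespace TateFamily₁

variable {k : Type*} [Field k] (T : TateFamily₁ k)

/-- `k[z][ϖ] → k(ϖ)[z]`: coefficients `k[z] ↪ k(ϖ)[z]` via the constants, and `ϖ ↦ ϖ` (a constant
of `k(ϖ)[z]`). [folklore] -/
def toParamPoly : Polynomial (Polynomial k) →+* Polynomial (RatFunc k) :=
  Polynomial.eval₂RingHom (Polynomial.mapRingHom (algebraMap k (RatFunc k)))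
    (Polynomial.C (RatFunc.X : RatFunc k))

/-- The integrand `F = P/Q` as a rational function of `z` over `K₀ = k(ϖ)`. [folklore] -/
def toRatFunc : RatFunc (RatFunc k) :=
  algebraMap _ _ (toParamPoly T.P) / algebraMap _ _ (toParamPoly T.Q)

/-- The reduced denominator of `F` divides `Q` (viewed in `k(ϖ)[z]`). [folklore] -/
theorem denom_toRatFunc_dvd : T.toRatFunc.denom ∣ toParamPoly T.Q :=
  RatFunc.denom_div_dvd _ _

section Poles

variable {K : Type*} [Field K] [Algebra k K] [Algebra (RatFunc k) K]
  [IsScalarTower k (RatFunc k) K]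

/-- Two-variable evaluation `k[z][ϖ] → K`, `z ↦ p`, `ϖ ↦ w`. [folklore] -/
def evalAt (p w : K) : Polynomial (Polynomial k) →+* K :=
  Polynomial.eval₂RingHom (Polynomial.aeval p : Polynomial k →ₐ[k] K).toRingHom w

omit [Algebra (RatFunc k) K] [IsScalarTower k (RatFunc k) K] in
/-- `evalAt` on the variable `ϖ`. [folklore] -/
@[simp] theorem evalAt_X (p w : K) : evalAt (k := k) p w X = w := by
  simp [evalAt]

omit [Algebra (RatFunc k) K] [IsScalarTower k (RatFunc k) K] in
/-- `evalAt` on a coefficient `q ∈ k[z]`. [folklore] -/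
@[simp] theorem evalAt_C (p w : K) (q : Polynomial k) : evalAt p w (C q) = aeval p q := by
  simp [evalAt]

/-- Evaluating the image in `k(ϖ)[z]` at `z = p ∈ K` is two-variable evaluation at `(p, ϖ)`.
[folklore] -/
theorem aeval_toParamPoly (p : K) (R : Polynomial (Polynomial k)) :
    aeval p (toParamPoly R) = evalAt p (algebraMap (RatFunc k) K RatFunc.X) R := by
  have : (Polynomial.aeval p : Polynomial (RatFunc k) →ₐ[RatFunc k] K).toRingHom.comp toParamPoly =
      evalAt (k := k) p (algebraMap (RatFunc k) K RatFunc.X) := by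
    refine Polynomial.ringHom_ext (fun q => ?_) ?_
    · show aeval p (toParamPoly (C q)) = evalAt p _ (C q)
      rw [evalAt_C, toParamPoly, Polynomial.coe_eval₂RingHom, Polynomial.eval₂_C,
        Polynomial.coe_mapRingHom, Polynomial.aeval_map_algebraMap]
    · simp [toParamPoly]
  exact congr_fun (congr_arg DFunLike.coe this) R

omit [Algebra k K] [IsScalarTower k (RatFunc k) K] in
/-- A pole branch `p ∈ K` of `F` is a root of the image of `Q` in `k(ϖ)[z]`. [folklore] -/
theorem aeval_toParamPoly_Q_eq_zero {p : K} (hp : p ∈ landauSet K T.toRatFunc) :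
    aeval p (toParamPoly T.Q) = 0 :=
  Polynomial.aeval_eq_zero_of_dvd_aeval_eq_zero T.denom_toRatFunc_dvd ((mem_landauSet_iff K).1 hp)

/-- Hence `Q(p; ϖ) = 0` for every pole branch `p`. [folklore] -/
theorem evalAt_Q_eq_zero {p : K} (hp : p ∈ landauSet K T.toRatFunc) :
    evalAt p (algebraMap (RatFunc k) K RatFunc.X) T.Q = 0 := by
  rw [← aeval_toParamPoly]
  exact T.aeval_toParamPoly_Q_eq_zero hp

omit [Algebra (RatFunc k) K] [IsScalarTower k (RatFunc k) K] in
/-- Ultrametric estimate: a polynomial with integral coefficients evaluated at an integral element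
is integral. [folklore] -/
theorem _root_.Literature.NumberTheory.Transcendental.AyoubRel.Landau.Place.map_eval₂_le_one
    (c : Landau.Place k K) {R : Type*} [CommRing R] (f : R →+* K) (hf : ∀ r, c.val (f r) ≤ 1)
    {x : K} (hx : c.val x ≤ 1) (q : Polynomial R) : c.val (q.eval₂ f x) ≤ 1 := by
  induction q using Polynomial.induction_on with
  | C a => simpa using hf a
  | add p q hp hq =>
    rw [Polynomial.eval₂_add]
    exact le_trans (Valuation.map_add _ _ _) (max_le hp hq)
  | monomial n a _ =>
    rw [Polynomial.eval₂_mul, Polynomial.eval₂_C, Polynomial.eval₂_X_pow, map_mul, map_pow]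
    exact mul_le_one' (hf a) (pow_le_one' hx _)

omit [Algebra (RatFunc k) K] [IsScalarTower k (RatFunc k) K] in
/-- At a place where `p` and `w` are integral, `evalAt p w` takes integral values. [folklore] -/
theorem val_evalAt_le_one (c : Landau.Place k K) {p w : K} (hp : c.val p ≤ 1) (hw : c.val w ≤ 1)
    (R : Polynomial (Polynomial k)) : c.val (evalAt p w R) ≤ 1 := by
  haveI := c.isTrivialOn
  refine c.map_eval₂_le_one _ (fun q => ?_) hw R
  change c.val (Polynomial.aeval p q) ≤ 1
  rw [Polynomial.aeval_def]
  exact c.map_eval₂_le_one _ (fun a => Valuation.IsTrivialOn.valuation_algebraMap_le_one _ a) hp q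

/-- **Poles of a Tate family run to infinity.** At a place `c` of the parameter field lying over
`ϖ = 0` (`val_c ϖ < 1`), every pole branch `p` of `F(·; ϖ)` has a pole: `1 < val_c p`.
(If `p` were integral at `c`, then `0 = Q(p; ϖ) = ϖ · (Q div ϖ)(p; ϖ) + c₀` would force
`val_c c₀ < 1`, but `c₀ ∈ k^×` has valuation `1`.) [folklore] -/
theorem one_lt_val_of_mem_landauSet (c : Landau.Place k K)
    (hϖ : c.val (algebraMap (RatFunc k) K RatFunc.X) < 1) {p : K}
    (hp : p ∈ landauSet K T.toRatFunc) : 1 < c.val p := by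
  haveI := c.isTrivialOn
  set w : K := algebraMap (RatFunc k) K RatFunc.X with hw
  by_contra hle
  rw [not_lt] at hle
  -- `0 = Q(p; ϖ) = ϖ · (divX Q)(p; ϖ) + c₀`
  have h0 := T.evalAt_Q_eq_zero hp
  rw [← Polynomial.X_mul_divX_add T.Q, map_add, map_mul, evalAt_X, evalAt_C, T.coeff_Q_zero,
    Polynomial.aeval_C, ← hw] at h0
  have hc₀ : c.val (algebraMap k K T.c₀) = 1 := Valuation.IsTrivialOn.eq_one _ T.c₀_ne_zero
  have key : c.val (algebraMap k K T.c₀) < 1 := by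
    rw [eq_neg_of_add_eq_zero_right h0, Valuation.map_neg, map_mul]
    calc c.val w * c.val (evalAt p w T.Q.divX)
        ≤ c.val w := mul_le_of_le_one_right' (val_evalAt_le_one c hle hϖ.le _)
      _ < 1 := hϖ
  rw [hc₀] at key
  exact lt_irrefl _ key

/-- Hence every Landau function `g_p` of a Tate family is a principal unit at a place over `ϖ = 0`.
[folklore] -/
theorem landauDatum_mem_principalUnits (c : Landau.Place k K)
    (hϖ : c.val (algebraMap (RatFunc k) K RatFunc.X) < 1) (p : landauSet K T.toRatFunc) :
    landauDatum K T.toRatFunc p ∈ c.principalUnits :=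
  landauUnit_mem_principalUnits c (T.one_lt_val_of_mem_landauSet c hϖ p.2)

/-- **`Λ(F)` of a Tate family is the exact relation lattice**: over any parameter field `K ⊇ k(ϖ)`
possessing a place over `ϖ = 0`, the defect lattice of `F = P/Q` (relations among the `g_p` modulo
constants) equals `{n | ∏_p g_p^{n_p} = 1}`. [folklore] -/
theorem landauDefectLattice_eq_relationLattice (c : Landau.Place k K)
    (hϖ : c.val (algebraMap (RatFunc k) K RatFunc.X) < 1) :
    landauDefectLattice K k T.toRatFunc = Landau.relationLattice (landauDatum K T.toRatFunc) :=
  AyoubRel.landauDefectLattice_eq_relationLattice T.toRatFunc c fun p =>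
    T.one_lt_val_of_mem_landauSet c hϖ p.2

end Poles

/-! ### The canonical parameter field and the wrappers -/

/-- The parameter field of the Tate family: the splitting field of the reduced denominator of `F`
over `k(ϖ)` (a finite extension of `k(ϖ)`). [folklore] -/
abbrev paramField : Type _ := landauField T.toRatFunc

/-- The Landau set of the Tate family: the pole branches of `F(·; ϖ)` in the parameter field.
[folklore] -/
abbrev landauSet : Set T.paramField := AyoubRel.landauSet T.paramField T.toRatFunc

/-- The Landau incidence matrix `M(F)` of the Tate family (rows: places of the parameter field over
`k`; columns: pole branches; entries `ord_c g_p`). [folklore] -/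
def incidenceMatrix : Matrix (Landau.Place k T.paramField) T.landauSet ℤ :=
  landauIncidenceMatrix T.paramField k T.toRatFunc

/-- The defect lattice `Λ(F) ⊆ ℤ^{poles}` of the Tate family. [folklore] -/
def defectLattice : AddSubgroup (T.landauSet → ℤ) :=
  landauDefectLattice T.paramField k T.toRatFunc

/-- `Λ(F) ⊆ ker_ℤ M(F)`. [folklore] -/
theorem defectLattice_le_matrixKer : T.defectLattice ≤ Landau.matrixKer T.incidenceMatrix :=
  Landau.defectLattice_le_matrixKer _

/-- `Λ(F)` is saturated. [folklore] -/
theorem defectLattice_nsmulSaturated : T.defectLattice.toAddSubmonoid.NSMulSaturated :=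
  Landau.defectLattice_nsmulSaturated _

/-- On the canonical parameter field too, a place over `ϖ = 0` makes `Λ(F)` the exact relation
lattice. [folklore] -/
theorem defectLattice_eq_relationLattice_of_place (c : Landau.Place k T.paramField)
    (hϖ : c.val (algebraMap (RatFunc k) T.paramField RatFunc.X) < 1) :
    T.defectLattice = Landau.relationLattice (landauDatum T.paramField T.toRatFunc) :=
  T.landauDefectLattice_eq_relationLattice c hϖ

/-- **In characteristic zero, unconditionally**: the defect lattice of a Tate family (on its
canonical parameter field) is the lattice of exact multiplicative relations among the Landau
functions `g_p` — the constants do not survive the Tate degeneration. [folklore] -/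
theorem defectLattice_eq_relationLattice [CharZero k] :
    T.defectLattice = Landau.relationLattice (landauDatum T.paramField T.toRatFunc) := by
  obtain ⟨c, hc⟩ := Landau.Place.exists_val_X_lt_one k T.paramField
  exact T.defectLattice_eq_relationLattice_of_place c hc

end TateFamily₁

end Literature.NumberTheory.Transcendental.AyoubRel
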